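import Summits.CriticalPhenomena.CardyFormulaZ2.Theorems.CardyBondTriangularBondTriangularCardyCornerCrossing
import Summits.CriticalPhenomena.CardyFormulaZ2.Theorems.CardyBondTriangularBondTriangularCardyCornerMarks
import Summits.CriticalPhenomena.CardyFormulaZ2.Theorems.CardyBondTriangularBondTriangularCardyStubSeparatesOfIsPath
import HarnessLib

/-!
# Route CardyBondTriangular · crux `BondTriangularCardy` (stmt-CriticalPhenomena-4664), line `birth`:
# stub `stub_corner` — the corner normalisation `f²_δ(z_δ) → 1` at `R.pt 1`

Crux `Summit.CriticalPhenomena.CardyFormulaZ2.Theses.CardyBondTriangular.BondTriangularCardy`, line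
`birth`, stub `stub_corner : Sig.stub_corner` (reshape v4 of the line lead; the texts of
`Sig.stub_clDuality`, `Sig.stub_corner` below are verbatim from the lead's `Sig` file, and
`Sig.stub_separatesOfIsPath` is the landed stub file `…StubSeparatesOfIsPath`'s). The statement (the part `PartSig.corner` of the landed reduction
`discreteDomains_of_parts`): for ANY Chayes–Lei hexagon model `M` on the sites of `𝕋` whose
yellow AND blue paths satisfy a one-arm bound across annuli, and ANY discrete approximation
`G_δ` (`IsDiscreteApprox`) of a conformal rectangle `R = (Ω; p₀, p₁, p₂, p₃)`, there are
triangles `z_δ` of `G_δ` with centres in `Ω` tending to the marked point `p₁` (between the arcs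
`A₀` and `A₁`) at which the separating probability `f²_δ(z_δ) = P_M(E²_δ(z_δ))` — a yellow
self-avoiding path of hexagons of `G_δ` from `A₀` to `A₁` separating `z_δ` from the last stretch
`A₂ ∪ A₃` of the 3-marked domain `(G_δ; v₀, v₁, v₂)` — tends to `1`; FROM the Chayes–Lei duality
lemma (`Sig.stub_clDuality`, Lemma 5 of Bollobás–Riordan for the hexagon model) and the blocking
theorem for simple paths (`Sig.stub_separatesOfIsPath`), both hypotheses BY NAME (neighbouring
stubs of the line). This is the corner case of the boundary values of Bollobás–Riordan,
*Percolation* (CUP 2006), Ch. 7, proof of Claim 23, pp. 200–201, for the Chayes–Lei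
representation (where no colour symmetry is available, so that the value `1` at the corner is
proved directly and the sum-to-one on the arcs is recovered analytically by the lead).

## Proof

Fix `ε > 0`. Radii `r₀ ≪ r_N ≪ r₁ ≪ r₂` (depending on `ε` through the two arm bounds and the
moduli `η(γ)` of Claim 21, `IsDiscreteApprox.site_conn`) and, eventually in `δ`:
* `z_δ` (triangles with centres in `Ω` tending to `p₁`, `exists_faces_tendsto`) is joined to the
  marked site `v₁ → p₁` (`tendsto_markSite`) by a path of sites `S` of `G_δ` inside `B(p₁, r₀)`;
* four markable boundary positions `m 0 < m 1 < m 2 < m 3` around `v₁` (`exists_corner_marks`,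
  file `…CornerMarks`): tails of `[m 0, m 1)` at distance `≥ r_N` from `p₁`, tails at `m 1, m 2`
  within `2 r_N` — hence joined to `v₁` inside `N ⊆ B(p₁, r₁)` by Claim 21 — and tails of
  `[m 3, m 0 + #∂)` (the far parts of `A₀, A₁` and all of `A₂ ∪ A₃`, `eventually_le_dist_of_arc`)
  farther than `r₂`.
The duality lemma in the re-marked domain `(G_δ; m 0, m 1, m 2, m 3)` (`corner_alternative`)
gives EITHER a yellow crossing from `[m 0, m 1)` to `[m 2, m 3)`: made simple (`Walk.bypass`), if
it avoids `S` it separates `z_δ` from `A₂ ∪ A₃` by the blocking theorem in the re-marked domain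
`(G_δ; x_{m 2}, v₂, v₀, v₁)` (`exists_corner_remark`), i.e. `E²_δ(z_δ)` holds, and otherwise it
is a yellow arm from `B(p₁, r₀)` to distance `r_N` (its start); OR a blue crossing from
`[m 1, m 2)` to `[m 3, m 0 + #∂)`, which meets `N` (`exists_mem_support_near_of_blueCrossing`:
interleaved boundary-to-boundary paths of a discrete domain meet, the exclusivity half of
Lemma 5) and ends farther than `r₂`: a blue arm from `B(p₁, r₁)` to distance `r₂`. Hence
`1 - f²_δ(z_δ) ≤ P(yellow arm) + P(blue arm) ≤ 2ε/3` eventually.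

References: B. Bollobás, O. Riordan, *Percolation*, CUP 2006, Ch. 7, Lemma 5 p. 169, Claim 21
p. 193, proof of Claim 23 pp. 200–201 [BollobasRiordan2006]; L. Chayes, H. K. Lei, Rev. Math.
Phys. 19 (2007) §2.1–2.3 [ChayesLei2007].
-/

noncomputable section

namespace Summit.CriticalPhenomena.CardyFormulaZ2.Theorems.BondTriangularCardyLine

open Set Filter Topology Metric

/-! ### The registered signatures (verbatim from the line lead's `Sig` file, reshape v4) -/

/-- v4: the Chayes–Lei duality lemma (existence half of Bollobás–Riordan's Lemma 5 for the hexagon model with half-edge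
connectivity): in a 4-marked discrete domain, every CL configuration has a yellow stretch-0→stretch-2 crossing (hexagons of
the domain, none pure blue, consecutive ones clYellowGraph-adjacent, ends YellowTowards the stretch darts) or a blue
stretch-1→stretch-3 crossing (dually). Model-free combinatorics (W4's design, work/stubs/sig_CLDuality_designed.txt).
(ref: BollobasRiordan2006, Ch. 7 Lemma 5 p. 169; ChayesLei2007 §2.1) -/
def Sig.stub_clDuality : Prop :=
  ∀ (G : Literature.Probability.Percolation.TriMarkedDomain 4) (σ : Literature.Probability.Percolation.CLHexConfig), (∃ (du dv : Literature.Probability.LatticeModels.Site 2 × Literature.Probability.LatticeModels.Site 2) (P : Literature.Probability.LatticeModels.triGraph.Walk du.1 dv.1), du ∈ G.stretch 0 ∧ dv ∈ G.stretch 2 ∧ Literature.Probability.Percolation.YellowTowards σ du ∧ Literature.Probability.Percolation.YellowTowards σ dv ∧ (∀ x ∈ P.support, x ∈ G.verts ∧ σ x ≠ Literature.Probability.Percolation.CLHexState.B) ∧ ∀ d ∈ P.darts, (Literature.Probability.Percolation.clYellowGraph σ).Adj d.fst d.snd) ∨ (∃ (du dv : Literature.Probability.LatticeModels.Site 2 ×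 Literature.Probability.LatticeModels.Site 2) (P : Literature.Probability.LatticeModels.triGraph.Walk du.1 dv.1), du ∈ G.stretch 1 ∧ dv ∈ G.stretch 3 ∧ Literature.Probability.Percolation.BlueTowards σ du ∧ Literature.Probability.Percolation.BlueTowards σ dv ∧ (∀ x ∈ P.support, x ∈ G.verts ∧ σ x ≠ Literature.Probability.Percolation.CLHexState.Y) ∧ ∀ d ∈ P.darts, (Literature.Probability.Percolation.clBlueGraph σ).Adj d.fst d.snd)

/-- v4: the corner normalisation part of `Sig.discreteDomains` (W4's `PartSig.corner`), from the two arm bounds, the CL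
duality lemma and the blocking theorem, BY NAME. (ref: BollobasRiordan2006, Ch. 7 pp. 200–201) -/
def Sig.stub_corner : Prop :=
  Sig.stub_clDuality → Sig.stub_separatesOfIsPath →
  ∀ (M : Literature.Probability.Percolation.ChayesLeiHexPercolation), (∀ ε > (0 : ℝ), ∃ ρ > (0 : ℝ), ∃ C > (0 : ℝ), ∀ (δ : ℝ) (z : ℂ) (r₁ r₂ : ℝ), 0 < δ → C * δ ≤ r₁ → r₁ ≤ ρ * r₂ → (Literature.Probability.Percolation.clHexPercolation M).real {σ | ∃ x y : Literature.Probability.LatticeModels.Site 2, (Literature.Probability.Percolation.clYellowGraph σ).Reachable x y ∧ ‖Literature.Probability.LatticeModels.triMeshPoint δ x - z‖ < r₁ ∧ r₂ < ‖Literature.Probability.LatticeModels.triMeshPoint δ y - z‖} ≤ ε) → (∀ ε > (0 : ℝ), ∃ ρ > (0 : ℝ), ∃ C > (0 : ℝ), ∀ (δ : ℝ) (z : ℂ) (r₁ r₂ : ℝ), 0 < δ → C * δ ≤ r₁ → r₁ ≤ ρ * r₂ → (Literature.Probability.Percolation.clHexPercolation M).real {σ | ∃ x y : Literature.Probability.LatticeModels.Site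 2, (Literature.Probability.Percolation.clBlueGraph σ).Reachable x y ∧ ‖Literature.Probability.LatticeModels.triMeshPoint δ x - z‖ < r₁ ∧ r₂ < ‖Literature.Probability.LatticeModels.triMeshPoint δ y - z‖} ≤ ε) → ∀ (R : Literature.Probability.RandomPlanarGeometry.ConformalRectangle) (G : ℝ → Literature.Probability.Percolation.TriMarkedDomain 4), Literature.Probability.Percolation.IsDiscreteApprox R G → ∃ zs : ℝ → Literature.Probability.LatticeModels.HexVertex, (∀ᶠ δ in nhdsWithin (0 : ℝ) (Set.Ioi 0), zs δ ∈ (G δ).faces ∧ (δ : ℂ) * Literature.Probability.LatticeModels.hexCenter (zs δ) ∈ R.carrier) ∧ Filter.Tendsto (fun δ : ℝ => (δ : ℂ) * Literature.Probability.LatticeModels.hexCenter (zs δ)) (nhdsWithin (0 : ℝ) (Set.Ioi 0)) (nhds (R.pt 1)) ∧ Filter.Tendsto (fun δ => (G δ).dropLast.clSepProb M 2 (zs δ)) (nhdsWithin (0 : ℝ) (Set.Ioi 0)) (nhds 1)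

/-! ### The pointwise alternative: separation, a yellow arm or a blue arm -/

open MeasureTheory Literature.Probability.Percolation Literature.Probability.LatticeModels
open Literature.Probability.RandomPlanarGeometry.MarkedDomain

/-- **The corner alternative (deterministic).** Let `m 0 < m 1 < m 2 < m 3` be markable boundary
positions of `G = (G; v₀, v₁, v₂, v₃)` with distinct tails, `m 1 ≤ pos 1 < m 2`, `m 2 + 1 < pos 2`,
`m 3 ≤ pos 2`, the tail at `m 2` not `v₀`; let the `G`-face `z` have its vertices in `S` and be
joined to `v₁` by sites of `G` in `S`, and let the tails at `m 1`, `m 2` be joined to `v₁` by sites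
of `G` in `N`. Then, granted the duality lemma and the blocking theorem, every configuration
either lies in `E²(z)` (a yellow simple path from the stretch `0` to the stretch `1` of
`(G; v₀, v₁, v₂)` separating `z` from its last stretch), or has a site of `S` joined by a yellow
path to the tail of a position of `[m 0, m 1)`, or a site of `N` joined by a blue path to the
tail of a position of `[m 3, m 0 + #∂)`. -/
theorem corner_alternative (hdual : Sig.stub_clDuality) (hblock : Sig.stub_separatesOfIsPath)
    (G : TriMarkedDomain 4) (m : Fin 4 → ℕ) (hm : StrictMono m)
    (hL : ∀ j, m j < m 0 + (triBdryDarts G.verts).card) (hmk : ∀ j, G.Markable (m j))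
    (hinj : Function.Injective fun j => (triBdryIter G.verts G.base (m j)).1)
    (h1 : m 1 ≤ G.pos 1) (h2 : G.pos 1 < m 2) (h2' : m 2 + 1 < G.pos 2) (h3 : m 3 ≤ G.pos 2)
    (hX0 : (triBdryIter G.verts G.base (m 2)).1 ≠ G.markSite 0)
    (σ : CLHexConfig) {z : HexVertex} (hz : hexFaceVertices z ⊆ G.verts)
    {S : Set (Site 2)} (hzS : ∀ y ∈ hexFaceVertices z, y ∈ S)
    (hyS : ∃ y ∈ hexFaceVertices z, PathIn triGraph ((G.verts : Set (Site 2)) ∩ S) y (G.markSite 1))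
    {N : Set (Site 2)}
    (hN1 : PathIn triGraph ((G.verts : Set (Site 2)) ∩ N) (triBdryIter G.verts G.base (m 1)).1
      (G.markSite 1))
    (hN2 : PathIn triGraph ((G.verts : Set (Site 2)) ∩ N) (G.markSite 1)
      (triBdryIter G.verts G.base (m 2)).1) :
    σ ∈ G.dropLast.clSepEvent 2 z ∨
      (∃ x ∈ S, ∃ n, m 0 ≤ n ∧ n < m 1 ∧
        (clYellowGraph σ).Reachable x (triBdryIter G.verts G.base n).1) ∨
      (∃ x ∈ N, ∃ n, m 3 ≤ n ∧ n < m 0 + (triBdryDarts G.verts).card ∧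
        (clBlueGraph σ).Reachable x (triBdryIter G.verts G.base n).1) := by
  classical
  have hN0 : G.remarkNext m 0 = m 1 := rfl
  have hN1' : G.remarkNext m 1 = m 2 := rfl
  have hN2' : G.remarkNext m 2 = m 3 := rfl
  have hN3 : G.remarkNext m 3 = m 0 + (triBdryDarts G.verts).card := rfl
  have e1 : ((2 : Fin 3) + 1 : Fin 3) = 0 := by decide
  have e2 : ((2 : Fin 3) + 2 : Fin 3) = 1 := by decide
  rcases hdual (G.remark m hm hL hmk hinj) σ with
    ⟨du, dv, P, hu, hv, hYu, hYv, hsupp, hdarts⟩ | ⟨du, dv, P, hu, hv, -, -, hsupp, hdarts⟩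
  · -- a yellow crossing from `[m 0, m 1)` to `[m 2, m 3)`
    rw [G.remark_stretch m hm hL hmk hinj 0, hN0] at hu
    rw [G.remark_stretch m hm hL hmk hinj 2, hN2'] at hv
    obtain ⟨nu, hnu, rfl⟩ := Finset.mem_image.1 hu
    obtain ⟨nv, hnv, rfl⟩ := Finset.mem_image.1 hv
    rw [Finset.mem_Ico] at hnu hnv
    have hpath : P.bypass.IsPath := P.bypass_isPath
    have hsupp' : ∀ x ∈ P.bypass.support, x ∈ G.verts ∧ σ x ≠ CLHexState.B :=
      fun x hx => hsupp x (P.support_bypass_subset_support hx)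
    have hdarts' : ∀ d ∈ P.bypass.darts, (clYellowGraph σ).Adj d.fst d.snd :=
      fun d hd => hdarts d (P.darts_bypass_subset_darts hd)
    by_cases hmeet : ∃ x ∈ P.bypass.support, x ∈ S
    · obtain ⟨x, hxP, hxS⟩ := hmeet
      exact Or.inr (Or.inl ⟨x, hxS, nu, hnu.1, hnu.2,
        clYellowGraph_reachable_of_darts P.bypass hdarts' hxP⟩)
    · push Not at hmeet
      left
      obtain ⟨D, hDv, hD3, hDs, hDa0, hDa2⟩ := exists_corner_remark G (m 2) h2 h2' (hmk 2) hX0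
      have hvD : (triBdryIter G.verts G.base nv).1 ∈ D.arc 0 := hDa0 nv hnv.1 (by omega)
      have huD : (triBdryIter G.verts G.base nu).1 ∈ D.arc 2 := hDa2 nu (by omega)
      obtain ⟨y, hy, hyp⟩ := hyS
      have hsep : Separates D.verts {e | e ∈ P.bypass.edges} z (D.stretch 1) := by
        refine hblock D _ _ P.bypass hpath huD hvD (fun x hx => by rw [hDv]; exact (hsupp' x hx).1)
          z (by rw [hDv]; exact hz) (fun w hw hwP => hmeet w hwP (hzS w hw)) ⟨y, hy, ?_⟩
        rw [hDv, hD3]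
        exact hyp.mono fun x hx => ⟨hx.1, fun hxP => hmeet x hxP hx.2⟩
      rw [hDv, hDs] at hsep
      refine ⟨_, _, P.bypass, hpath, ?_, ?_, hYu, hYv, hsupp', hdarts', hsep⟩
      · rw [e1, G.dropLast_stretch_zero_eq]
        exact Finset.mem_image.2 ⟨nu, Finset.mem_Ico.2 ⟨Nat.zero_le _, by omega⟩, rfl⟩
      · rw [e2, G.dropLast_stretch_one_eq]
        exact Finset.mem_image.2 ⟨nv, Finset.mem_Ico.2 ⟨by omega, by omega⟩, rfl⟩
  · -- a blue crossing from `[m 1, m 2)` to `[m 3, m 0 + #∂)`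
    rw [G.remark_stretch m hm hL hmk hinj 1, hN1'] at hu
    rw [G.remark_stretch m hm hL hmk hinj 3, hN3] at hv
    obtain ⟨nt, hnt, rfl⟩ := Finset.mem_image.1 hu
    obtain ⟨ne, hne, rfl⟩ := Finset.mem_image.1 hv
    rw [Finset.mem_Ico] at hnt hne
    obtain ⟨x, hxP, hxN⟩ := exists_mem_support_near_of_blueCrossing G
      (hm.monotone (by decide : (0 : Fin 4) ≤ 1)) h1 h2 (hm (by decide : (2 : Fin 4) < 3)) N hN1 hN2
      hnt.1 hnt.2 hne.1 hne.2 P (fun x hx => (hsupp x hx).1)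
    exact Or.inr (Or.inr ⟨x, hxN, ne, hne.1, hne.2, clBlueGraph_reachable_of_darts P hdarts hxP⟩)

/-! ### The corner normalisation -/

/-- **Stub `stub_corner` (the registered signature `Sig.stub_corner`): the corner normalisation
`f²_δ(z_δ) → 1` at `R.pt 1` for a hexagon model with yellow and blue one-arm bounds, from the
Chayes–Lei duality lemma and the blocking theorem for simple paths, BY NAME.** See the module
docstring for the proof (Bollobás–Riordan 2006, Ch. 7, proof of Claim 23 pp. 200–201, for the
Chayes–Lei representation). -/
theorem stub_corner : Sig.stub_corner := by
  intro hdual hblock M hYarm hBarm R G hG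
  have hpcl : R.pt 1 ∈ closure R.carrier := frontier_subset_closure (R.pt_mem_frontier 1)
  obtain ⟨zs, hzs, hzt⟩ := hG.exists_faces_tendsto hpcl
  refine ⟨zs, hzs, hzt, ?_⟩
  -- the arcs `A₂, A₃` of `R` stay away from `p₁`
  have hn2 : R.pt 1 ∉ R.arc 2 := fun h =>
    (R.eq_pt_or_eq_pt_of_mem_arc (i := 2) (j := 1) (by decide) h (R.pt_mem_arc_self 1)).elim
      (fun e => absurd (R.pt_injective e) (by decide)) (fun e => absurd (R.pt_injective e) (by decide))
  have hn3 : R.pt 1 ∉ R.arc 3 := fun h =>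
    (R.eq_pt_or_eq_pt_of_mem_arc (i := 3) (j := 1) (by decide) h (R.pt_mem_arc_self 1)).elim
      (fun e => absurd (R.pt_injective e) (by decide)) (fun e => absurd (R.pt_injective e) (by decide))
  set c₀ : ℝ := min (infDist (R.pt 1) (R.arc 2)) (infDist (R.pt 1) (R.arc 3)) with hc₀def
  have hc₀ : 0 < c₀ :=
    lt_min (((R.isClosed_arc 2).notMem_iff_infDist_pos ⟨_, R.pt_mem_arc_self 2⟩).1 hn2)
      (((R.isClosed_arc 3).notMem_iff_infDist_pos ⟨_, R.pt_mem_arc_self 3⟩).1 hn3)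
  have hfar2 : ∀ w ∈ R.arc 2, c₀ ≤ dist w (R.pt 1) := fun w hw =>
    (min_le_left _ _).trans (by rw [dist_comm]; exact infDist_le_dist_of_mem hw)
  have hfar3 : ∀ w ∈ R.arc 3, c₀ ≤ dist w (R.pt 1) := fun w hw =>
    (min_le_right _ _).trans (by rw [dist_comm]; exact infDist_le_dist_of_mem hw)
  have hcarc : ∀ᶠ δ in 𝓝[>] (0 : ℝ), ∀ t, t ∈ (G δ).arc 2 ∨ t ∈ (G δ).arc 3 →
      c₀ / 2 ≤ dist (triMeshPoint δ t) (R.pt 1) := by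
    filter_upwards [hG.eventually_le_dist_of_arc hc₀ hfar2, hG.eventually_le_dist_of_arc hc₀ hfar3]
      with δ h2 h3 t ht
    rcases ht with ht | ht
    · exact h2 t ht
    · exact h3 t ht
  -- the marked sites `v₀, v₂, v₃` stay away from `p₁`, and `v₁ → p₁`
  obtain ⟨ρ₀, hρ₀, hρfar⟩ := hG.exists_eventually_le_dist_markSite 1
  have hv1 := hG.tendsto_markSite 1
  rw [Metric.tendsto_nhds]
  intro ε hε
  -- the scales: blue arm `r₁ → r₂`, near radius `rN`, yellow arm `r₀ → rN / 2`
  obtain ⟨ρB, hρB, CB, hCB, hB⟩ := hBarm (ε / 3) (by positivity)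
  set r₂ : ℝ := min (c₀ / 4) (ρ₀ / 2) with hr₂def
  have hr₂ : 0 < r₂ := by positivity
  have hr₂c : r₂ ≤ c₀ / 4 := min_le_left _ _
  have hr₂ρ : r₂ ≤ ρ₀ / 2 := min_le_right _ _
  set r₁ : ℝ := min (ρB * r₂) (r₂ / 2) with hr₁def
  have hr₁ : 0 < r₁ := by positivity
  have hr₁ρ : r₁ ≤ ρB * r₂ := min_le_left _ _
  have hr₁r₂ : r₁ ≤ r₂ / 2 := min_le_right _ _
  obtain ⟨η, hη, hconn⟩ := hG.site_conn (r₁ / 2) (by positivity)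
  set rN : ℝ := min (η / 8) (r₁ / 8) with hrNdef
  have hrN : 0 < rN := by positivity
  have hrNη : rN ≤ η / 8 := min_le_left _ _
  have hrNr₁ : rN ≤ r₁ / 8 := min_le_right _ _
  obtain ⟨ρY, hρY, CY, hCY, hY⟩ := hYarm (ε / 3) (by positivity)
  set r₀ : ℝ := min (ρY * (rN / 2)) (rN / 4) with hr₀def
  have hr₀ : 0 < r₀ := by positivity
  have hr₀ρ : r₀ ≤ ρY * (rN / 2) := min_le_left _ _
  have hr₀rN : r₀ ≤ rN / 4 := min_le_right _ _
  obtain ⟨η₀, hη₀, hconn₀⟩ := hG.site_conn (r₀ / 2) (by positivity)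
  -- thresholds
  set θ₁ : ℝ := min (η₀ / 4) (r₀ / 4) with hθ₁def
  have hθ₁ : 0 < θ₁ := by positivity
  have hθ₁η : θ₁ ≤ η₀ / 4 := min_le_left _ _
  have hθ₁r : θ₁ ≤ r₀ / 4 := min_le_right _ _
  set θ₂ : ℝ := min θ₁ (min (ρ₀ / 26) (min (r₁ / CB) (r₀ / CY))) with hθ₂def
  have hθ₂ : 0 < θ₂ := by positivity
  have hK : ∀ᶠ δ : ℝ in 𝓝[>] 0, dist ((δ : ℂ) * hexCenter (zs δ)) (R.pt 1) < θ₁ :=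
    hzt.eventually (ball_mem_nhds _ hθ₁)
  have hV : ∀ᶠ δ in 𝓝[>] (0 : ℝ), dist (triMeshPoint δ ((G δ).markSite 1)) (R.pt 1) < θ₁ :=
    hv1.eventually (ball_mem_nhds _ hθ₁)
  have hsmall : ∀ᶠ δ in 𝓝[>] (0 : ℝ), δ ∈ Ioo 0 θ₂ := Ioo_mem_nhdsGT hθ₂
  filter_upwards [hzs, hcarc, hρfar, hconn, hconn₀, hK, hV, hsmall]
    with δ hzsδ hcarcδ hρfarδ hconnδ hconn₀δ hKδ hVδ hδ
  obtain ⟨hδ0, hδθ⟩ := hδ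
  have hδθ₁ : δ < θ₁ := hδθ.trans_le (min_le_left _ _)
  have hδρ₀ : δ < ρ₀ / 26 := hδθ.trans_le ((min_le_right _ _).trans (min_le_left _ _))
  have hδCB : δ < r₁ / CB :=
    hδθ.trans_le ((min_le_right _ _).trans ((min_le_right _ _).trans (min_le_left _ _)))
  have hδCY : δ < r₀ / CY :=
    hδθ.trans_le ((min_le_right _ _).trans ((min_le_right _ _).trans (min_le_right _ _)))
  have hδCB' : CB * δ ≤ r₁ := by
    have h := (lt_div_iff₀ hCB).1 hδCB
    linarith [mul_comm δ CB]
  have hδCY' : CY * δ ≤ r₀ := by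
    have h := (lt_div_iff₀ hCY).1 hδCY
    linarith [mul_comm δ CY]
  rw [Real.dist_eq]
  set p : ℂ := R.pt 1 with hpdef
  set K : ℂ := (δ : ℂ) * hexCenter (zs δ) with hKdef
  -- Step 1: the four marks
  obtain ⟨m, hm, hLm, hmk, hinj, h1, h2, h2', h3, hX0, hfar1, hnear1, hnear2, hfar3⟩ :=
    exists_corner_marks (G δ) δ rN r₂ p hδ0 (by linarith) (by linarith)
      (by linarith) (by have := hρfarδ 0 (by decide); linarith)
      (by have := hρfarδ 2 (by decide); linarith) (fun t ht => by have := hcarcδ t ht; linarith)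
  -- Step 2: the attachment set `S` of `z_δ` and the near set `N`
  set y₀ : Site 2 := faceVertex (zs δ) 0 with hy₀def
  have hzv : hexFaceVertices (zs δ) ⊆ (G δ).verts := ((G δ).mem_faces).1 hzsδ.1
  have hy₀ : y₀ ∈ (G δ).verts := hzv (faceVertex_mem _ _)
  have hy₀K : dist (triMeshPoint δ y₀) K ≤ δ := by
    have := dist_triMeshPoint_hexCenter_le (faceVertex_mem (zs δ) 0) δ
    rwa [abs_of_pos hδ0] at this
  have hy₀p : dist (triMeshPoint δ y₀) p < δ + θ₁ := by
    linarith [dist_triangle (triMeshPoint δ y₀) K p]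
  set S : Set (Site 2) := {v | dist (triMeshPoint δ y₀) (triMeshPoint δ v) < r₀ / 2} with hSdef
  have hSpath : PathIn triGraph (((G δ).verts : Set (Site 2)) ∩ S) y₀ ((G δ).markSite 1) := by
    refine hconn₀δ y₀ hy₀ _ ((G δ).markSite_mem_verts 1) ?_
    linarith [dist_triangle (triMeshPoint δ y₀) p (triMeshPoint δ ((G δ).markSite 1)),
      dist_comm p (triMeshPoint δ ((G δ).markSite 1))]
  have hzS : ∀ w ∈ hexFaceVertices (zs δ), w ∈ S := by
    intro w hw
    have h1 := dist_triMeshPoint_hexCenter_le hw δ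
    rw [abs_of_pos hδ0] at h1
    show dist (triMeshPoint δ y₀) (triMeshPoint δ w) < r₀ / 2
    linarith [dist_triangle (triMeshPoint δ y₀) K (triMeshPoint δ w), dist_comm K (triMeshPoint δ w)]
  have hSball : ∀ v ∈ S, ‖triMeshPoint δ v - p‖ < r₀ := by
    intro v hv
    have hv' : dist (triMeshPoint δ y₀) (triMeshPoint δ v) < r₀ / 2 := hv
    rw [← dist_eq_norm]
    linarith [dist_triangle (triMeshPoint δ v) (triMeshPoint δ y₀) p,
      dist_comm (triMeshPoint δ v) (triMeshPoint δ y₀)]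
  set a₁ : Site 2 := (triBdryIter (G δ).verts (G δ).base (m 1)).1 with ha₁def
  set a₂ : Site 2 := (triBdryIter (G δ).verts (G δ).base (m 2)).1 with ha₂def
  have ha₁v : a₁ ∈ (G δ).verts := (G δ).iter_fst_mem (m 1)
  have ha₂v : a₂ ∈ (G δ).verts := (G δ).iter_fst_mem (m 2)
  set N : Set (Site 2) := {v | dist (triMeshPoint δ a₁) (triMeshPoint δ v) < r₁ / 2} ∪
    {v | dist (triMeshPoint δ ((G δ).markSite 1)) (triMeshPoint δ v) < r₁ / 2} with hNdef
  have hN1 : PathIn triGraph (((G δ).verts : Set (Site 2)) ∩ N) a₁ ((G δ).markSite 1) := by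
    refine (hconnδ a₁ ha₁v _ ((G δ).markSite_mem_verts 1) ?_).mono fun v hv => ⟨hv.1, Or.inl hv.2⟩
    linarith [dist_triangle (triMeshPoint δ a₁) p (triMeshPoint δ ((G δ).markSite 1)),
      dist_comm p (triMeshPoint δ ((G δ).markSite 1))]
  have hN2 : PathIn triGraph (((G δ).verts : Set (Site 2)) ∩ N) ((G δ).markSite 1) a₂ := by
    refine (hconnδ _ ((G δ).markSite_mem_verts 1) a₂ ha₂v ?_).mono fun v hv => ⟨hv.1, Or.inr hv.2⟩
    linarith [dist_triangle (triMeshPoint δ ((G δ).markSite 1)) p (triMeshPoint δ a₂),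
      dist_comm p (triMeshPoint δ a₂)]
  have hNball : ∀ v ∈ N, ‖triMeshPoint δ v - p‖ < r₁ := by
    intro v hv
    rw [← dist_eq_norm]
    rcases hv with hv | hv
    · have hv' : dist (triMeshPoint δ a₁) (triMeshPoint δ v) < r₁ / 2 := hv
      linarith [dist_triangle (triMeshPoint δ v) (triMeshPoint δ a₁) p,
        dist_comm (triMeshPoint δ v) (triMeshPoint δ a₁)]
    · have hv' : dist (triMeshPoint δ ((G δ).markSite 1)) (triMeshPoint δ v) < r₁ / 2 := hv
      linarith [dist_triangle (triMeshPoint δ v) (triMeshPoint δ ((G δ).markSite 1)) p,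
        dist_comm (triMeshPoint δ v) (triMeshPoint δ ((G δ).markSite 1))]
  -- Step 3: the event inclusion `E²(z_δ)ᶜ ⊆ (yellow arm) ∪ (blue arm)`
  set E : Set CLHexConfig := (G δ).dropLast.clSepEvent 2 (zs δ) with hEdef
  set YA : Set CLHexConfig := {σ | ∃ x y : Site 2, (clYellowGraph σ).Reachable x y ∧
    ‖triMeshPoint δ x - p‖ < r₀ ∧ rN / 2 < ‖triMeshPoint δ y - p‖} with hYAdef
  set BA : Set CLHexConfig := {σ | ∃ x y : Site 2, (clBlueGraph σ).Reachable x y ∧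
    ‖triMeshPoint δ x - p‖ < r₁ ∧ r₂ < ‖triMeshPoint δ y - p‖} with hBAdef
  have hsub : Eᶜ ⊆ YA ∪ BA := by
    intro σ hσ
    rcases corner_alternative hdual hblock (G δ) m hm hLm hmk hinj h1 h2 h2' h3 hX0 σ hzv hzS
        ⟨y₀, faceVertex_mem _ _, hSpath⟩ hN1 hN2 with hEσ | ⟨x, hxS, n, hn1, hn2, hreach⟩ |
        ⟨x, hxN, n, hn1, hn2, hreach⟩
    · exact absurd hEσ hσ
    · refine Or.inl ⟨x, _, hreach, hSball x hxS, ?_⟩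
      rw [← dist_eq_norm]
      linarith [hfar1 n hn1 hn2]
    · refine Or.inr ⟨x, _, hreach, hNball x hxN, ?_⟩
      rw [← dist_eq_norm]
      exact hfar3 n hn1 hn2
  -- Step 4: probability
  have hEm : MeasurableSet E := (G δ).dropLast.measurableSet_clSepEvent 2 (zs δ)
  have hcompl : (clHexPercolation M).real Eᶜ = 1 - (clHexPercolation M).real E :=
    probReal_compl_eq_one_sub hEm
  have hYA : (clHexPercolation M).real YA ≤ ε / 3 := hY δ p r₀ (rN / 2) hδ0 hδCY' hr₀ρ
  have hBA : (clHexPercolation M).real BA ≤ ε / 3 := hB δ p r₁ r₂ hδ0 hδCB' hr₁ρ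
  have hf : (G δ).dropLast.clSepProb M 2 (zs δ) = (clHexPercolation M).real E := rfl
  have hle : 1 - (clHexPercolation M).real E ≤ ε / 3 + ε / 3 := by
    rw [← hcompl]
    calc (clHexPercolation M).real Eᶜ ≤ (clHexPercolation M).real (YA ∪ BA) :=
          measureReal_mono hsub (measure_ne_top _ _)
      _ ≤ (clHexPercolation M).real YA + (clHexPercolation M).real BA := measureReal_union_le _ _
      _ ≤ ε / 3 + ε / 3 := add_le_add hYA hBA
  have hle1 : (clHexPercolation M).real E ≤ 1 := measureReal_le_one
  rw [hf, abs_lt]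
  constructor <;> linarith

end Summit.CriticalPhenomena.CardyFormulaZ2.Theorems.BondTriangularCardyLine

end
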